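import Summits.Schanuel.Schanuel.Theorems.ZilberEacFibreCurvePuiseuxGeneral
import HarnessLib

/-!
# The exponential-polynomial regime, CXV (a): the BOTTOM-EDGE REDUCTION of a degenerate fibre
# relation modulo the base curve

HONEST FRAMING.  Cell `pub-schanuel` (Zilber's Exponential-Algebraic Closedness, case ladder;
host summit Schanuel), seat 2, gen 34.  Pure algebra for file CXV (b).  The degenerate part
`G₀ ∈ ℂ[x₀][x₁][y₀]` of a fibre relation need not literally satisfy the hypotheses of the Puiseux
theorems (`F ∤` top coefficient, `F ∤ G₀(0)`): its top coefficients may vanish on the curve and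
`y₀ = 0` may be a root.  What matters is that `G₀ mod F` has a NONZERO ROOT, i.e. at least two
coefficients not divisible by `F` (a bottom EDGE of positive length of the Newton polygon).
**`exists_bottomEdge_reduction`**: then `G₀ ≡ y₀^m · R (mod F)` coefficientwise, with `R` of
positive degree, `F ∤ lc(R)`, `F ∤ R(0)`; **`exists_bottomEdge_root`**: hence a Puiseux root
`ψ(σ)σ^L` (`ψ(0) ≠ 0`) of `T = y₀^m R` along any place of `F = 0` (file CXIV (a)), and `T` agrees
with `G₀` on the curve.  [folklore]; nothing here bears on Mantova–Masser's question (OPEN),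
EC(3,2) (OPEN) or Schanuel's conjecture (neither used nor implied); EAC ⇏ SC.
-/

noncomputable section

open Filter Topology Polynomial

set_option linter.dupNamespace false

namespace Summit.Schanuel.Schanuel.Theorems

section BottomEdge

variable (F : ℂ[X][X])

/-- Coefficients of a shifted row polynomial `Σ_{i ≤ d} C(a_{m+i}) X^i`. [folklore] -/
theorem coeff_shiftedRows (a : ℕ → ℂ[X][X]) (m d i : ℕ) :
    (∑ j ∈ Finset.range (d + 1), Polynomial.C (a (m + j)) * Polynomial.X ^ j :
      Polynomial ℂ[X][X]).coeff i = if i < d + 1 then a (m + i) else 0 := by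
  rw [Polynomial.finsetSum_coeff]
  simp only [Polynomial.coeff_C_mul_X_pow]
  rw [Finset.sum_ite_eq (Finset.range (d + 1)) i]
  simp only [Finset.mem_range]

variable {F}

/-- **Bottom-edge reduction.**  If `G₀ ∈ ℂ[x₀][x₁][y]` has two coefficients not divisible by `F`,
then `G₀ ≡ y^m R (mod F)` coefficientwise with `deg R ≥ 1`, `F ∤ lc(R)`, `F ∤ R(0)`, and
`lc(y^m R) = lc(R)`. [folklore] -/
theorem exists_bottomEdge_reduction {G₀ : Polynomial ℂ[X][X]}
    (h2 : ∃ i j, i < j ∧ ¬ F ∣ G₀.coeff i ∧ ¬ F ∣ G₀.coeff j) :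
    ∃ (m : ℕ) (R : Polynomial ℂ[X][X]), 1 ≤ R.natDegree ∧ ¬ F ∣ R.leadingCoeff ∧ ¬ F ∣ R.coeff 0 ∧
      ¬ F ∣ (Polynomial.X ^ m * R).leadingCoeff ∧
      ∀ j, F ∣ (G₀ - Polynomial.X ^ m * R).coeff j := by
  classical
  obtain ⟨i₀, j₀, hij, hi₀, hj₀⟩ := h2
  obtain ⟨n, -, hn, habove⟩ := exists_top_not_dvd_coeff (F := F) ⟨j₀, hj₀⟩
  have hexm : ∃ i, ¬ F ∣ G₀.coeff i := ⟨i₀, hi₀⟩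
  set m : ℕ := Nat.find hexm with hmdef
  have hm : ¬ F ∣ G₀.coeff m := Nat.find_spec hexm
  have hbelow : ∀ j, j < m → F ∣ G₀.coeff j := by
    intro j hj
    have h := Nat.find_min hexm (by rw [← hmdef]; exact hj)
    push Not at h
    exact h
  have hmi₀ : m ≤ i₀ := by rw [hmdef]; exact Nat.find_min' hexm hi₀
  have hj₀n : j₀ ≤ n := by
    by_contra h
    exact hj₀ (habove j₀ (by omega))
  have hmn : m < n := by omega
  set d : ℕ := n - m with hd
  set R : Polynomial ℂ[X][X] :=
    ∑ j ∈ Finset.range (d + 1), Polynomial.C (G₀.coeff (m + j)) * Polynomial.X ^ j with hR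
  have hRc : ∀ i, R.coeff i = if i < d + 1 then G₀.coeff (m + i) else 0 :=
    fun i => coeff_shiftedRows (fun j => G₀.coeff j) m d i
  have hGn0 : G₀.coeff n ≠ 0 := fun h => hn (by rw [h]; exact dvd_zero F)
  have hRdeg : R.natDegree = d := by
    refine le_antisymm ?_ ?_
    · rw [Polynomial.natDegree_le_iff_coeff_eq_zero]
      intro i hi
      rw [hRc, if_neg (by omega)]
    · refine Polynomial.le_natDegree_of_ne_zero ?_
      rw [hRc, if_pos (Nat.lt_succ_self d), hd, Nat.add_sub_cancel' hmn.le]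
      exact hGn0
  have hRlc : R.leadingCoeff = G₀.coeff n := by
    rw [Polynomial.leadingCoeff, hRdeg, hRc, if_pos (Nat.lt_succ_self d), hd,
      Nat.add_sub_cancel' hmn.le]
  have hR0 : R ≠ 0 := fun h => hGn0 (by rw [← hRlc, h, Polynomial.leadingCoeff_zero])
  have hTlc : (Polynomial.X ^ m * R).leadingCoeff = G₀.coeff n := by
    rw [Polynomial.leadingCoeff_mul, Polynomial.leadingCoeff_X_pow, one_mul, hRlc]
  refine ⟨m, R, by rw [hRdeg]; omega, by rw [hRlc]; exact hn, ?_, by rw [hTlc]; exact hn, fun j => ?_⟩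
  · rw [hRc, if_pos (Nat.succ_pos d), add_zero]
    exact hm
  · rw [Polynomial.coeff_sub, Polynomial.coeff_X_pow_mul']
    by_cases hjm : m ≤ j
    · rw [if_pos hjm, hRc]
      by_cases hjn : j - m < d + 1
      · rw [if_pos hjn, Nat.add_sub_cancel' hjm, sub_self]
        exact dvd_zero F
      · rw [if_neg hjn, sub_zero]
        exact habove j (by omega)
    · rw [if_neg hjm, sub_zero]
      exact hbelow j (by omega)

variable (F)

/-- **The root along a place from a bottom edge.**  `F` irreducible of positive `x₁`-degree, a
place `x₀ = s^{-k}`, `x₁ = Φ(s)s^{-M}`, and `G₀ ∈ ℂ[x₀][x₁][y]` with two coefficients not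
divisible by `F`: there are `T ∈ ℂ[x₀][x₁][y]` with `F ∤ lc(T)` and `G₀ ≡ T (mod F)`
coefficientwise — so `T` and `G₀` have the same values along the place — and a Puiseux root
`ψ(σ)σ^L` of `T` along the place (`s = σ^e`, `ψ(0) ≠ 0`). [folklore] (new) -/
theorem exists_bottomEdge_root (hFirr : Irreducible F) (hn : 1 ≤ F.natDegree)
    {k : ℕ} (hk : 1 ≤ k) (M : ℕ) {Φ : ℂ → ℂ} (hΦan : AnalyticAt ℂ Φ 0)
    (hplace : ∀ᶠ s in 𝓝[≠] (0 : ℂ),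
      (F.map (Polynomial.evalRingHom (s ^ k)⁻¹)).eval (Φ s * (s ^ M)⁻¹) = 0)
    {G₀ : Polynomial ℂ[X][X]} (h2 : ∃ i j, i < j ∧ ¬ F ∣ G₀.coeff i ∧ ¬ F ∣ G₀.coeff j) :
    ∃ (T : Polynomial ℂ[X][X]) (e : ℕ) (L : ℤ) (ψ : ℂ → ℂ), ¬ F ∣ T.leadingCoeff ∧
      (∀ j, F ∣ (G₀ - T).coeff j) ∧ 1 ≤ e ∧ AnalyticAt ℂ ψ 0 ∧ ψ 0 ≠ 0 ∧
      ∀ᶠ σ in 𝓝[≠] (0 : ℂ),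
        (T.map (Polynomial.eval₂RingHom (Polynomial.evalRingHom ((σ ^ e) ^ k)⁻¹)
          (Φ (σ ^ e) * ((σ ^ e) ^ M)⁻¹))).eval (ψ σ * σ ^ L) = 0 := by
  obtain ⟨m, R, hRd, hRtop, hRbot, hTlc, hdiff⟩ := exists_bottomEdge_reduction h2
  obtain ⟨e, L, ψ, he, hψan, hψ0, hroot⟩ :=
    exists_fibreCurve_puiseuxRoot_general F hFirr hn hk M hΦan hplace R hRd hRtop hRbot
  refine ⟨Polynomial.X ^ m * R, e, L, ψ, hTlc, hdiff, he, hψan, hψ0, ?_⟩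
  filter_upwards [hroot] with σ hσ
  rw [Polynomial.map_mul, Polynomial.map_pow, Polynomial.map_X, Polynomial.eval_mul,
    Polynomial.eval_pow, Polynomial.eval_X, hσ, mul_zero]

/-- Values along the curve: if `G₀ ≡ T (mod F)` coefficientwise then `G₀` and `T` have the same
evaluations at every point of `F = 0`. [folklore] -/
theorem eval_eq_of_forall_dvd_sub {G₀ T : Polynomial ℂ[X][X]} (hdiff : ∀ j, F ∣ (G₀ - T).coeff j)
    {x₀ x₁ : ℂ} (hx : (F.map (Polynomial.evalRingHom x₀)).eval x₁ = 0) (y : ℂ) :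
    (G₀.map (Polynomial.eval₂RingHom (Polynomial.evalRingHom x₀) x₁)).eval y =
      (T.map (Polynomial.eval₂RingHom (Polynomial.evalRingHom x₀) x₁)).eval y := by
  have hF : (Polynomial.eval₂RingHom (Polynomial.evalRingHom x₀) x₁) F = 0 := by
    rw [Polynomial.coe_eval₂RingHom, ← Polynomial.eval_map]
    exact hx
  have h := eval_map_eq_zero_of_forall_dvd F hdiff _ hF y
  rw [Polynomial.map_sub, Polynomial.eval_sub, sub_eq_zero] at h
  exact h

end BottomEdge

end Summit.Schanuel.Schanuel.Theorems

end
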